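import Summits.CriticalPhenomena.PercolationContinuityZ3.Theorems.PercNearOneGluingNoHeavyQuantSecondWeightSingles
import HarnessLib

/-!
# QUANT lane R8 — the chain lemma for general independent levels (reduction to the singles chain lemma)

builds on p205010 (kernel theorem, internal audit signed; external expert review pending)

Support file (`--supports stmt-CriticalPhenomena-4575`), QUANT lane lead (gen 8), rung R8 of
`run/shared/lean/prim/quant/LADDER.md`; memo `prim-quant-lead-g7/LEAD-NOTES-G7.md` N17 Step 2 (2a: the two-point / per-level affine
reduction).  Continues `…QuantSecondWeightOdds.lean`, `…QuantSecondWeightSingles.lean` (items `(w, p)`, `EFS`, `σS`, `Adm`,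
`secondWeight_singles`).  Pure real algebra on lists; no definitions (local notations), no sorries, standard axioms.

**Setting.**  A list of LEVELS `(w, z, s, t, m)`, heaviest first: a level carries an independent random number of units of weight `w`, with
`P(0) = z`, `P(1) = s`, `P(≥ 2) = t`, mean `m`.  `W` = weight of the second unit overall (`x` if exactly one unit, `0` if none), `F` = weight of
the first unit (`x` if none): `E W(l :: L) = z·E W(L) + s·F(L) + t·w`, `F(l :: L) = (1 − z)·w + z·F(L)` (`EFG[L, x] = (E W, F)`), `σG = Σ w m`,
`ZG = ∏ z`.  `Lvl`: `z, s, t ≥ 0`, `z + s + t = 1`, `x ≤ w ≤ 1`; `LAdm`: moreover `m ≥ 0` and EMPTY (`z = 1`, `s = t = m = 0`) or `n ≥ 1` units with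
`s ≤ m ≤ s + n·t`, `n·x ≤ w·m`; `Sgl`: `(w, 1 − p, p, 0, p)` with `x ≤ w p`.  On a tree (`…QuantFarTreeMultiCompanion.lean`) level `k` = the
companions hanging off the `k`-th vertex of the distinguished relay's chain, `w` = probability that the chain is open down to it.
* `EFG_bary` — `(E W, F)` is the `(z, s, t)`-barycentre of the systems with the level surely empty / one unit / `≥ 2` units; `EFG_erase`,
  `EFG_two_ge`, `EFG_two_ge_erase`, `efg_ge_x_mul` ((E0) `E W ≥ x (1 − ZG)`).
* `level_reduce` — one-level reduction: with `A ≤ C`, `w ≤ C`, `x ≤ B`, `s ≤ m ≤ s + n t`, `n x ≤ w m`, the barycentre `zA + sB + tC` is `≥ x`,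
  or `m ≤ 1` and it is `≥ (1 − m)A + mB` (the level replaced by the single of the same mean).
* `Quant.SecondWeight.secondWeight_levels` — **THE CHAIN LEMMA** (N17 Step 2): admissible levels with non-increasing weights give
  `E W ≥ x · min(1, Σ w m)` (induction `levels_aux` over a growing prefix of singles; base `secondWeight_singles`).
Exact numerical re-check: lead g8 `work/explore/check_abstract.py` (3 071 level lists incl. empty levels and blobs, 6 355 instances of
`level_reduce`; 0 violations).  [this work]
-/

namespace Summit.CriticalPhenomena.PercolationContinuityZ3.Theorems

namespace Quant

namespace SecondWeight

open Finset

/-- `EFS[L, x] = (E W, E F)` for items `(w, p)` (as in `…QuantSecondWeightOdds.lean`). -/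
local notation3 "EFS[" L ", " x "]" =>
  (List.foldr (fun (l : ℝ × ℝ) (acc : ℝ × ℝ) => (l.2 * acc.2 + (1 - l.2) * acc.1, l.1 * l.2 + (1 - l.2) * acc.2)) ((0 : ℝ), (x : ℝ)) L)
/-- `σS[L] = Σ w p` for items. -/
local notation3 "σS[" L "]" => (List.sum (List.map (fun (l : ℝ × ℝ) => l.1 * l.2) L))
/-- a level `(w, z, s, t, m)`: weight, `P(count = 0)`, `P(count = 1)`, `P(count ≥ 2)`, mean count -/
local notation3 "𝕃" => ℝ × ℝ × ℝ × ℝ × ℝ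
/-- `EFG[L, x] = (E W, E F)` for general levels: `E W(l :: L) = z·E W(L) + s·F(L) + t·w`, `F(l :: L) = (1 − z) w + z F(L)`. -/
local notation3 "EFG[" L ", " x "]" =>
  (List.foldr (fun (l : ℝ × ℝ × ℝ × ℝ × ℝ) (acc : ℝ × ℝ) =>
      (l.2.1 * acc.1 + l.2.2.1 * acc.2 + l.2.2.2.1 * l.1, (1 - l.2.1) * l.1 + l.2.1 * acc.2)) ((0 : ℝ), (x : ℝ)) L)
/-- `σG[L] = Σ w m`: expected total occurring weight. -/
local notation3 "σG[" L "]" => (List.sum (List.map (fun (l : ℝ × ℝ × ℝ × ℝ × ℝ) => l.1 * l.2.2.2.2) L))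
/-- `ZG[L] = ∏ z`: no unit occurs. -/
local notation3 "ZG[" L "]" => (List.foldr (fun (l : ℝ × ℝ × ℝ × ℝ × ℝ) (acc : ℝ) => l.2.1 * acc) (1 : ℝ) L)
/-- a well-formed level at base `x`: `z, s, t ≥ 0`, `z + s + t = 1`, `x ≤ w ≤ 1`. -/
local notation3 "Lvl[" x ", " l "]" =>
  (0 ≤ (l : ℝ × ℝ × ℝ × ℝ × ℝ).2.1 ∧ 0 ≤ (l : ℝ × ℝ × ℝ × ℝ × ℝ).2.2.1 ∧ 0 ≤ (l : ℝ × ℝ × ℝ × ℝ × ℝ).2.2.2.1 ∧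
    (l : ℝ × ℝ × ℝ × ℝ × ℝ).2.1 + (l : ℝ × ℝ × ℝ × ℝ × ℝ).2.2.1 + (l : ℝ × ℝ × ℝ × ℝ × ℝ).2.2.2.1 = 1 ∧
    (x : ℝ) ≤ (l : ℝ × ℝ × ℝ × ℝ × ℝ).1 ∧ (l : ℝ × ℝ × ℝ × ℝ × ℝ).1 ≤ 1)
/-- an ADMISSIBLE level: well-formed, `m ≥ 0`, and either EMPTY (`z = 1`, `s = t = m = 0`) or carrying `n ≥ 1` units with
`s ≤ m ≤ s + n t` and `n x ≤ w m` (every unit has absolute marginal `≥ x`). -/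
local notation3 "LAdm[" x ", " l "]" =>
  (Lvl[x, l] ∧ 0 ≤ (l : ℝ × ℝ × ℝ × ℝ × ℝ).2.2.2.2 ∧
    (((l : ℝ × ℝ × ℝ × ℝ × ℝ).2.1 = 1 ∧ (l : ℝ × ℝ × ℝ × ℝ × ℝ).2.2.1 = 0 ∧ (l : ℝ × ℝ × ℝ × ℝ × ℝ).2.2.2.1 = 0 ∧
        (l : ℝ × ℝ × ℝ × ℝ × ℝ).2.2.2.2 = 0) ∨
      ∃ n : ℕ, 1 ≤ n ∧ (l : ℝ × ℝ × ℝ × ℝ × ℝ).2.2.1 ≤ (l : ℝ × ℝ × ℝ × ℝ × ℝ).2.2.2.2 ∧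
        (l : ℝ × ℝ × ℝ × ℝ × ℝ).2.2.2.2 ≤ (l : ℝ × ℝ × ℝ × ℝ × ℝ).2.2.1 + n * (l : ℝ × ℝ × ℝ × ℝ × ℝ).2.2.2.1 ∧
        (n : ℝ) * x ≤ (l : ℝ × ℝ × ℝ × ℝ × ℝ).1 * (l : ℝ × ℝ × ℝ × ℝ × ℝ).2.2.2.2))
/-- a SINGLE level `(w, 1 − p, p, 0, p)` with `x ≤ w p`, `p ≤ 1`. -/
local notation3 "Sgl[" x ", " l "]" =>
  (Lvl[x, l] ∧ (l : ℝ × ℝ × ℝ × ℝ × ℝ).2.2.2.1 = 0 ∧ (l : ℝ × ℝ × ℝ × ℝ × ℝ).2.2.2.2 = (l : ℝ × ℝ × ℝ × ℝ × ℝ).2.2.1 ∧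
    (x : ℝ) ≤ (l : ℝ × ℝ × ℝ × ℝ × ℝ).1 * (l : ℝ × ℝ × ℝ × ℝ × ℝ).2.2.1)

variable {x : ℝ}

/-! ### Recursions and basic bounds -/

/-- `EFG` of a cons. -/
theorem EFG_cons (l : 𝕃) (L : List 𝕃) (x : ℝ) :
    EFG[l :: L, x] = (l.2.1 * (EFG[L, x]).1 + l.2.2.1 * (EFG[L, x]).2 + l.2.2.2.1 * l.1,
      (1 - l.2.1) * l.1 + l.2.1 * (EFG[L, x]).2) := rfl

/-- `ZG` of a cons. -/
theorem ZG_cons (l : 𝕃) (L : List 𝕃) : ZG[l :: L] = l.2.1 * ZG[L] := rfl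

/-- `σG` of a cons. -/
theorem σG_cons (l : 𝕃) (L : List 𝕃) : σG[l :: L] = l.1 * l.2.2.2.2 + σG[L] := by
  simp only [List.map_cons, List.sum_cons]

/-- `σG` of an append. -/
theorem σG_append (L M : List 𝕃) : σG[L ++ M] = σG[L] + σG[M] := by
  simp only [List.map_append, List.sum_append]

/-- Lower bounds `E W ≥ 0`, `F ≥ x` (well-formed levels, `x ≥ 0`). [this work] -/
theorem EFG_lower (hx : 0 ≤ x) (L : List 𝕃) (hL : ∀ l ∈ L, Lvl[x, l]) : 0 ≤ (EFG[L, x]).1 ∧ x ≤ (EFG[L, x]).2 := by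
  induction L with
  | nil => simp
  | cons l L ih =>
    obtain ⟨hz, hs, ht, hzst, hxw, hw1⟩ := hL l (by simp)
    have ih' := ih (fun l' hl' => hL l' (by simp [hl']))
    rw [EFG_cons]
    constructor
    · show 0 ≤ l.2.1 * (EFG[L, x]).1 + l.2.2.1 * (EFG[L, x]).2 + l.2.2.2.1 * l.1
      have hF0 : 0 ≤ (EFG[L, x]).2 := le_trans hx ih'.2
      have hw0 : 0 ≤ l.1 := le_trans hx hxw
      exact add_nonneg (add_nonneg (mul_nonneg hz ih'.1) (mul_nonneg hs hF0)) (mul_nonneg ht hw0)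
    · show x ≤ (1 - l.2.1) * l.1 + l.2.1 * (EFG[L, x]).2
      nlinarith [ih'.2]

/-- Upper bounds by a common weight bound `c ≥ x`: `E W ≤ c`, `F ≤ c`. [this work] -/
theorem EFG_upper (hx : 0 ≤ x) {c : ℝ} (hxc : x ≤ c) (L : List 𝕃) (hL : ∀ l ∈ L, Lvl[x, l] ∧ l.1 ≤ c) :
    (EFG[L, x]).1 ≤ c ∧ (EFG[L, x]).2 ≤ c := by
  induction L with
  | nil => simp [hxc, le_trans hx hxc]
  | cons l L ih =>
    obtain ⟨⟨hz, hs, ht, hzst, hxw, hw1⟩, hc⟩ := hL l (by simp)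
    have hL' : ∀ l' ∈ L, Lvl[x, l'] ∧ l'.1 ≤ c := fun l' hl' => hL l' (by simp [hl'])
    have ih' := ih hL'
    have hlow := EFG_lower hx L (fun l' hl' => (hL' l' hl').1)
    rw [EFG_cons]
    constructor
    · show l.2.1 * (EFG[L, x]).1 + l.2.2.1 * (EFG[L, x]).2 + l.2.2.2.1 * l.1 ≤ c
      nlinarith [ih'.1, ih'.2]
    · show (1 - l.2.1) * l.1 + l.2.1 * (EFG[L, x]).2 ≤ c
      nlinarith [ih'.2]

/-- `0 ≤ ZG ≤ 1`, and a level with `z = 0` kills `ZG`. [this work] -/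
theorem ZG_bounds (L : List 𝕃) (hL : ∀ l ∈ L, 0 ≤ l.2.1 ∧ l.2.1 ≤ 1) :
    0 ≤ ZG[L] ∧ ZG[L] ≤ 1 ∧ ((∃ l ∈ L, l.2.1 = 0) → ZG[L] = 0) := by
  induction L with
  | nil => simp
  | cons l L ih =>
    have hl := hL l (by simp)
    obtain ⟨h0, h1, h2⟩ := ih (fun l' hl' => hL l' (by simp [hl']))
    rw [ZG_cons]
    refine ⟨mul_nonneg hl.1 h0, by nlinarith, fun ⟨l', hl', hz⟩ => ?_⟩
    rcases List.mem_cons.1 hl' with rfl | h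
    · rw [hz, zero_mul]
    · rw [h2 ⟨l', h, hz⟩, mul_zero]

/-- **(E0)** `E W ≥ x (1 − ZG)`: once a unit occurs, `W ≥ x`. [this work] -/
theorem efg_ge_x_mul (hx : 0 ≤ x) (L : List 𝕃) (hL : ∀ l ∈ L, Lvl[x, l]) : x * (1 - ZG[L]) ≤ (EFG[L, x]).1 := by
  induction L with
  | nil => simp
  | cons l L ih =>
    obtain ⟨hz, hs, ht, hzst, hxw, hw1⟩ := hL l (by simp)
    have hL' : ∀ l' ∈ L, Lvl[x, l'] := fun l' hl' => hL l' (by simp [hl'])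
    have ih' := ih hL'
    have hF := (EFG_lower hx L hL').2
    have hZ := ZG_bounds L (fun l' hl' => by
      obtain ⟨h1, h2, h3, h4, -, -⟩ := hL' l' hl'
      exact ⟨h1, by linarith⟩)
    rw [EFG_cons, ZG_cons]
    show x * (1 - l.2.1 * ZG[L]) ≤ l.2.1 * (EFG[L, x]).1 + l.2.2.1 * (EFG[L, x]).2 + l.2.2.2.1 * l.1
    have ht' : l.2.2.2.1 = 1 - l.2.1 - l.2.2.1 := by linarith
    rw [ht']
    nlinarith [mul_le_mul_of_nonneg_left ih' hz, mul_le_mul_of_nonneg_left hF hs, mul_le_mul_of_nonneg_left hxw ht]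

/-! ### One level inside a system: erasure, barycentric decomposition, and comparison of the three pure versions -/

/-- An EMPTY level (`z = 1`, `s = t = 0`) does not change `(E W, F)`. [this work] -/
theorem EFG_erase (T M : List 𝕃) (w m x : ℝ) : EFG[T ++ (w, 1, 0, 0, m) :: M, x] = EFG[T ++ M, x] := by
  rw [List.foldr_append, List.foldr_append, EFG_cons]
  congr 1
  ext <;> simp

/-- **Barycentric decomposition in one level**: `(E W, F)` of a system is the `(z, s, t)`-combination of the three systems in which
that level is surely empty / surely one unit / surely at least two units (the fold maps are affine). [this work] -/
theorem EFG_bary (T M : List 𝕃) (w z s m x : ℝ) :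
    EFG[T ++ (w, z, s, 1 - z - s, m) :: M, x] =
      (z * (EFG[T ++ (w, 1, 0, 0, m) :: M, x]).1 + s * (EFG[T ++ (w, 0, 1, 0, m) :: M, x]).1 +
          (1 - z - s) * (EFG[T ++ (w, 0, 0, 1, m) :: M, x]).1,
        z * (EFG[T ++ (w, 1, 0, 0, m) :: M, x]).2 + s * (EFG[T ++ (w, 0, 1, 0, m) :: M, x]).2 +
          (1 - z - s) * (EFG[T ++ (w, 0, 0, 1, m) :: M, x]).2) := by
  induction T with
  | nil =>
    simp only [List.nil_append, EFG_cons]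
    ext <;> ring
  | cons a T ih =>
    simp only [List.cons_append, EFG_cons, ih]
    ext <;> ring

/-- The version with the level surely carrying `≥ 2` units has `E W ≥ w` and `F ≥ w`, when the earlier levels weigh `≥ w`. [this work] -/
theorem EFG_two_ge (hx : 0 ≤ x) (T M : List 𝕃) (w m : ℝ) (hT : ∀ a ∈ T, Lvl[x, a] ∧ w ≤ a.1) :
    w ≤ (EFG[T ++ (w, 0, 0, 1, m) :: M, x]).1 ∧ w ≤ (EFG[T ++ (w, 0, 0, 1, m) :: M, x]).2 := by
  induction T with
  | nil => simp
  | cons a T ih =>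
    obtain ⟨⟨hz, hs, ht, hzst, hxw, hw1⟩, hwa⟩ := hT a (by simp)
    obtain ⟨h1, h2⟩ := ih (fun a' ha' => hT a' (by simp [ha']))
    rw [List.cons_append, EFG_cons]
    constructor
    · show w ≤ a.2.1 * (EFG[T ++ (w, 0, 0, 1, m) :: M, x]).1 + a.2.2.1 * (EFG[T ++ (w, 0, 0, 1, m) :: M, x]).2 + a.2.2.2.1 * a.1
      nlinarith [mul_le_mul_of_nonneg_left h1 hz, mul_le_mul_of_nonneg_left h2 hs, mul_le_mul_of_nonneg_left hwa ht]
    · show w ≤ (1 - a.2.1) * a.1 + a.2.1 * (EFG[T ++ (w, 0, 0, 1, m) :: M, x]).2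
      nlinarith [mul_le_mul_of_nonneg_left h2 hz, mul_le_mul_of_nonneg_left hwa (by linarith : 0 ≤ 1 - a.2.1)]
    -- (unused: `hx`, kept for a uniform interface)

/-- The `≥ 2`-units version dominates the erased system (monotonicity of the folds), when the later levels weigh `≤ w`. [this work] -/
theorem EFG_two_ge_erase (hx : 0 ≤ x) (T M : List 𝕃) (w m : ℝ) (hxw : x ≤ w) (hT : ∀ a ∈ T, Lvl[x, a])
    (hM : ∀ b ∈ M, Lvl[x, b] ∧ b.1 ≤ w) :
    (EFG[T ++ M, x]).1 ≤ (EFG[T ++ (w, 0, 0, 1, m) :: M, x]).1 ∧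
      (EFG[T ++ M, x]).2 ≤ (EFG[T ++ (w, 0, 0, 1, m) :: M, x]).2 := by
  induction T with
  | nil =>
    have h := EFG_upper hx hxw M hM
    simp only [List.nil_append, EFG_cons]
    constructor <;> linarith [h.1, h.2]
  | cons a T ih =>
    obtain ⟨hz, hs, ht, hzst, hxa, ha1⟩ := hT a (by simp)
    obtain ⟨h1, h2⟩ := ih (fun a' ha' => hT a' (by simp [ha']))
    simp only [List.cons_append, EFG_cons]
    constructor
    · nlinarith [mul_le_mul_of_nonneg_left h1 hz, mul_le_mul_of_nonneg_left h2 hs]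
    · nlinarith [mul_le_mul_of_nonneg_left h2 hz]

/-- Real-arithmetic core of the reduction of one level to a single (or to the bound `E W ≥ x`). [this work] -/
theorem level_reduce (x w z s t m A B C : ℝ) (n : ℕ) (hx : 0 < x) (hn : 1 ≤ n) (hz : 0 ≤ z) (hs : 0 ≤ s) (ht : 0 ≤ t)
    (hzst : z + s + t = 1) (hsm : s ≤ m) (hm : m ≤ s + n * t) (hnx : (n : ℝ) * x ≤ w * m) (hA0 : 0 ≤ A) (hCA : A ≤ C)
    (hCw : w ≤ C) (hBx : x ≤ B) (hxw : x ≤ w) :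
    x ≤ z * A + s * B + t * C ∨ (m ≤ 1 ∧ (1 - m) * A + m * B ≤ z * A + s * B + t * C) := by
  have hn' : (1 : ℝ) ≤ n := by exact_mod_cast hn
  have hCx : x ≤ C := le_trans hxw hCw
  by_cases hAB : B ≤ A
  · -- every branch is worth at least `x`
    left
    nlinarith [mul_le_mul_of_nonneg_left (le_trans hBx hAB) hz, mul_le_mul_of_nonneg_left hBx hs, mul_le_mul_of_nonneg_left hCx ht]
  · push Not at hAB
    by_cases hslope : (n : ℝ) * (B - A) ≤ C - A
    · -- the single end: `diff = t (C − A) − (m − s)(B − A) ≥ 0`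
      have hdiff : (1 - m) * A + m * B ≤ z * A + s * B + t * C := by
        have h1 : (m - s) * (B - A) ≤ (n * t) * (B - A) :=
          mul_le_mul_of_nonneg_right (by linarith) (by linarith : (0 : ℝ) ≤ B - A)
        have h2 : t * (n * (B - A)) ≤ t * (C - A) := mul_le_mul_of_nonneg_left hslope ht
        have hz' : z = 1 - s - t := by linarith
        rw [hz']
        nlinarith
      by_cases hm1 : m ≤ 1
      · exact Or.inr ⟨hm1, hdiff⟩
      · left
        push Not at hm1
        have : B ≤ (1 - m) * A + m * B := by nlinarith
        linarith
    · -- the blob end: `n · value ≥ (n − m) A + m C ≥ m C ≥ m w ≥ n x`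
      left
      push Not at hslope
      have hmn : m ≤ n := by nlinarith
      have hz' : z = 1 - s - t := by linarith
      have h1 : (n : ℝ) * (z * A + s * B + t * C) = n * A + n * s * (B - A) + n * t * (C - A) := by rw [hz']; ring
      have h2 : (m - s) * (C - A) ≤ n * t * (C - A) := mul_le_mul_of_nonneg_right (by linarith) (by linarith)
      have h3 : 0 ≤ s * (n * (B - A) - (C - A)) := mul_nonneg hs (by linarith)
      have h4 : m * w ≤ m * C := mul_le_mul_of_nonneg_left hCw (by linarith)
      have h5 : (n : ℝ) * x ≤ n * (z * A + s * B + t * C) := by nlinarith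
      exact le_of_mul_le_mul_left h5 (by linarith)

/-! ### From general levels to singles -/

/-- A list of SINGLE levels has the `(E W, F)` and `σ` of the corresponding `(w, p)` items. [this work] -/
theorem EFG_singles (T : List 𝕃) (hT : ∀ l ∈ T, Sgl[x, l]) :
    EFG[T, x] = EFS[List.map (fun l : ℝ × ℝ × ℝ × ℝ × ℝ => (l.1, l.2.2.1)) T, x] ∧
      σG[T] = σS[List.map (fun l : ℝ × ℝ × ℝ × ℝ × ℝ => (l.1, l.2.2.1)) T] := by
  induction T with
  | nil => simp
  | cons l T ih =>
    obtain ⟨⟨hz, hs, ht, hzst, hxw, hw1⟩, ht0, hms, hxws⟩ := hT l (by simp)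
    obtain ⟨h1, h2⟩ := ih (fun l' hl' => hT l' (by simp [hl']))
    have hz' : l.2.1 = 1 - l.2.2.1 := by linarith
    constructor
    · rw [EFG_cons, List.map_cons, EFS_cons, h1, ht0, hz']
      ext <;> simp only <;> ring
    · rw [σG_cons, List.map_cons, σS_cons, h2, hms]

/-- The main induction: a prefix `T` of single levels followed by admissible levels `M`, weights non-increasing, satisfies
`E W ≥ x·min(1, σ)`.  Each general level is either erased (empty), or shown to give `E W ≥ x` outright (a heavy blob or a sure unit),
or replaced by the single of the same mean without increasing `E W` (`level_reduce` on the barycentric decomposition); the all-singles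
base is `secondWeight_singles`. [this work] -/
theorem levels_aux (hx : 0 < x) (M : List 𝕃) :
    ∀ T : List 𝕃, (∀ l ∈ T, Sgl[x, l]) → (∀ l ∈ M, LAdm[x, l]) →
      (List.map (fun l : ℝ × ℝ × ℝ × ℝ × ℝ => l.1) (T ++ M)).Pairwise (fun u v => v ≤ u) →
      x * min 1 σG[T ++ M] ≤ (EFG[T ++ M, x]).1 := by
  induction M with
  | nil =>
    intro T hT _ _
    rw [List.append_nil]
    obtain ⟨h1, h2⟩ := EFG_singles T hT
    rw [h1, h2]
    refine secondWeight_singles hx _ fun l hl => ?_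
    obtain ⟨l', hl', rfl⟩ := List.mem_map.1 hl
    obtain ⟨⟨hz, hs, ht, hzst, hxw, hw1⟩, ht0, hms, hxws⟩ := hT l' hl'
    exact ⟨hs, by simp only; linarith, hw1, hxws⟩
  | cons l M ih =>
    intro T hT hM hsort
    obtain ⟨w, z, s, t, m⟩ := l
    have hl := hM (w, z, s, t, m) (by simp)
    have hM' : ∀ l' ∈ M, LAdm[x, l'] := fun l' hl' => hM l' (by simp [hl'])
    obtain ⟨⟨hz, hs, ht, hzst, hxw, hw1⟩, hm0, hcase⟩ := hl
    simp only at hz hs ht hzst hxw hw1 hm0 hcase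
    -- sortedness consequences
    have hsort' := hsort
    rw [List.map_append, List.pairwise_append, List.map_cons, List.pairwise_cons] at hsort'
    obtain ⟨-, ⟨hsM, -⟩, hsTM⟩ := hsort'
    have hTw : ∀ a ∈ T, w ≤ a.1 := fun a ha =>
      hsTM a.1 (List.mem_map.2 ⟨a, ha, rfl⟩) w (by simp)
    have hMw : ∀ b ∈ M, b.1 ≤ w := fun b hb => hsM b.1 (List.mem_map.2 ⟨b, hb, rfl⟩)
    -- sortedness of any list with the same weights
    have hsort_of : ∀ l' : 𝕃, l'.1 = w →
        (List.map (fun l : ℝ × ℝ × ℝ × ℝ × ℝ => l.1) ((T ++ [l']) ++ M)).Pairwise (fun u v => v ≤ u) := by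
      intro l' hl'
      have : List.map (fun l : ℝ × ℝ × ℝ × ℝ × ℝ => l.1) ((T ++ [l']) ++ M) =
          List.map (fun l : ℝ × ℝ × ℝ × ℝ × ℝ => l.1) (T ++ (w, z, s, t, m) :: M) := by
        simp [hl']
      rw [this]; exact hsort
    have hTl : ∀ a ∈ T, Lvl[x, a] := fun a ha => (hT a ha).1
    have hMl : ∀ b ∈ M, Lvl[x, b] := fun b hb => (hM' b hb).1
    rcases hcase with ⟨rfl, rfl, rfl, rfl⟩ | ⟨n, hn, hsm, hmn, hnx⟩
    · -- empty level: erase it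
      have hE := EFG_erase T M w 0 x
      have hσ : σG[T ++ (w, (1 : ℝ), (0 : ℝ), (0 : ℝ), (0 : ℝ)) :: M] = σG[T ++ M] := by
        rw [σG_append, σG_append, σG_cons]; simp
      rw [hE, hσ]
      refine ih T hT hM' ?_
      have hsub : List.Sublist (T ++ M) (T ++ ((w, (1 : ℝ), (0 : ℝ), (0 : ℝ), (0 : ℝ)) :: M)) :=
        (List.sublist_cons_self _ M).append_left T
      exact hsort.sublist (hsub.map _)
    · -- a genuine level: reduce
      have ht' : t = 1 - z - s := by linarith
      set A := (EFG[T ++ (w, 1, 0, 0, m) :: M, x]).1 with hA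
      set B := (EFG[T ++ (w, 0, 1, 0, m) :: M, x]).1 with hB
      set C := (EFG[T ++ (w, 0, 0, 1, m) :: M, x]).1 with hC
      have hval : (EFG[T ++ (w, z, s, t, m) :: M, x]).1 = z * A + s * B + t * C := by
        rw [ht', EFG_bary]
      have hA' : A = (EFG[T ++ M, x]).1 := by rw [hA, EFG_erase]
      have hA0 : 0 ≤ A := by
        rw [hA']
        exact (EFG_lower hx.le (T ++ M) (fun a ha => by
          rcases List.mem_append.1 ha with h | h
          · exact hTl a h
          · exact hMl a h)).1
      have hCA : A ≤ C := by
        rw [hA']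
        exact (EFG_two_ge_erase hx.le T M w m hxw hTl (fun b hb => ⟨hMl b hb, hMw b hb⟩)).1
      have hCw : w ≤ C := (EFG_two_ge hx.le T M w m (fun a ha => ⟨hTl a ha, hTw a ha⟩)).1
      have hBx : x ≤ B := by
        have hall : ∀ a ∈ T ++ (w, (0 : ℝ), (1 : ℝ), (0 : ℝ), m) :: M, Lvl[x, a] := by
          intro a ha
          rw [List.mem_append, List.mem_cons] at ha
          rcases ha with h | rfl | h
          · exact hTl a h
          · exact ⟨le_rfl, zero_le_one, le_rfl, by norm_num, hxw, hw1⟩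
          · exact hMl a h
        have h0 := efg_ge_x_mul hx.le _ hall
        have hZ := (ZG_bounds (T ++ (w, (0 : ℝ), (1 : ℝ), (0 : ℝ), m) :: M) (fun a ha => by
          obtain ⟨h1, h2, h3, h4, -, -⟩ := hall a ha
          exact ⟨h1, by linarith⟩)).2.2 ⟨(w, 0, 1, 0, m), by simp, rfl⟩
        rw [hZ] at h0
        rw [hB]; linarith
      rcases level_reduce x w z s t m A B C n hx hn hz hs ht hzst hsm hmn hnx hA0 hCA hCw hBx hxw with hge | ⟨hm1, hle⟩
      · rw [hval]
        have : x * min 1 σG[T ++ (w, z, s, t, m) :: M] ≤ x * 1 := mul_le_mul_of_nonneg_left (min_le_left _ _) hx.le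
        linarith
      · -- replace the level by the single `(w, 1 − m, m, 0, m)` and recurse with a longer prefix
        have hsingle : (EFG[T ++ (w, 1 - m, m, 0, m) :: M, x]).1 = (1 - m) * A + m * B := by
          have := EFG_bary T M w (1 - m) m m x
          have e0 : (1 : ℝ) - (1 - m) - m = 0 := by ring
          rw [e0] at this
          rw [this]
          simp only
          ring
        have hT' : ∀ a ∈ T ++ [(w, 1 - m, m, 0, m)], Sgl[x, a] := by
          intro a ha
          rw [List.mem_append, List.mem_singleton] at ha
          rcases ha with h | rfl
          · exact hT a h
          · refine ⟨⟨by simp only; linarith, by simp only; linarith, le_rfl, by simp only; ring, hxw, hw1⟩, rfl, rfl, ?_⟩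
            simp only
            have : (1 : ℝ) * x ≤ n * x := mul_le_mul_of_nonneg_right (by exact_mod_cast hn) hx.le
            linarith
        have hrec := ih (T ++ [(w, 1 - m, m, 0, m)]) hT' hM' (hsort_of _ rfl)
        rw [List.append_assoc, List.singleton_append, hsingle] at hrec
        have hσ : σG[T ++ (w, 1 - m, m, (0 : ℝ), m) :: M] = σG[T ++ (w, z, s, t, m) :: M] := by
          rw [σG_append, σG_append, σG_cons, σG_cons]
        rw [hσ] at hrec
        rw [hval]
        linarith

/-- **THE CHAIN LEMMA FOR GENERAL LEVELS** (LEAD-NOTES-G7 N17 Step 2).  For a list of admissible levels (independent counts with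
`P(0), P(1), P(≥2) = z, s, t`, mean `m`, weight `w`, `x ≤ w ≤ 1`, non-increasing weights; each nonempty level carries `n ≥ 1` units with
`s ≤ m ≤ s + n t` and `n x ≤ w m`), the expected weight of the second occurring unit (`x` if exactly one unit occurs, `0` if none)
is at least `x · min(1, Σ w m)`. [this work] -/
theorem secondWeight_levels (hx : 0 < x) (L : List 𝕃) (hL : ∀ l ∈ L, LAdm[x, l])
    (hsort : (List.map (fun l : ℝ × ℝ × ℝ × ℝ × ℝ => l.1) L).Pairwise (fun u v => v ≤ u)) :
    x * min 1 σG[L] ≤ (EFG[L, x]).1 := by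
  have := levels_aux hx L [] (by simp) hL (by simpa using hsort)
  simpa only [List.nil_append] using this

end SecondWeight

end Quant

end Summit.CriticalPhenomena.PercolationContinuityZ3.Theorems
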